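import Literature.RingTheory.KTheory.MilnorKResidueSequenceModPrime
import HarnessLib

/-!
# EXAMPLE 1.7 away from the residue characteristic: for a henselian discretely valued field `E` with FINITE residue
# field `F̄` and a prime `p ≠ char F̄`, `K_nE/pK_nE = 0` for `n ≥ 3` and `∂ : K₂E/p ≅ K₁F̄/p`
# (Milnor, *Algebraic K-theory and quadratic forms*, §1 Example 1.7 with §2 Lemma 2.6 and §1 Example 1.5)

Family `hodge`, lane `lit-hodgefound` (foundations library; seat `lit-hodgefound-p27`, generation 51, row g51-#10);
topic `RingTheory/KTheory`.  Sequel of `MilnorKResidueSequenceModPrime` (g42-#5: LEMMA 2.6 for henselian `E` and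
`p ≠ char F̄` — `ModP A p = A/pA`, `modPMap`, the split packaging `bijective_psiModP_prod_boundaryModP_of_henselian :
[x] ↦ (ψ[x], ∂[x])` is a bijection `K_{n+1}E/p → K_{n+1}F̄/p × K_nF̄/p`, `boundaryModP_surjective`) and of
`MilnorKGroupsFiniteField` (g28: EXAMPLE 1.5 `eq_zero_of_finite : K_{n+2}F̄ = 0` for finite `F̄`).  PROVED THEOREMS only;
no definition, no named fact, no instance, no notation, 0 `sorry`, net debt 0 (D-0026).

## The source, verbatim

J. Milnor, *Algebraic K-theory and quadratic forms*, Invent. Math. 9 (1970) 318–344 (held `paper:doi-10-1007-bf01425486`;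
bib key `Milnor1970`), §1 Example 1.7 (p0004 L18–L26): «Let F be a local field (i.e. complete under a discrete
valuation with finite residue class field), and let m be the number of roots of unity in F. Calvin Moore [10]
proves that K₂F is the direct sum of a cyclic group of order m and a divisible group.  We will show that K_nF is
divisible for n ≥ 3. Consider the algebra K_*F/pK_*F over Z/pZ; where p is a fixed prime. If p does not divide m,
then Moore's theorem clearly implies that K₂F/pK₂F = 0. […]»  §2 LEMMA 2.6 (p0010 L17–L21): «Suppose that a field E
is complete under a discrete valuation with residue class field Ē = F. Then for any prime p distinct from the
characteristic of F, there is a natural split exact sequence 0 → K_nF/pK_nF → K_nE/pK_nE →∂ K_{n−1}F/pK_{n−1}F → 0.»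
§1 Example 1.5 (p0004 L8–L12): «If the field is finite, then K₂F = 0. […] K_nF = 0 for n > 2 also.»

For a prime `p` DISTINCT FROM THE RESIDUE CHARACTERISTIC, LEMMA 2.6 and EXAMPLE 1.5 give Example 1.7's conclusions
directly (without Moore's theorem or the norm residue symbol): both outer terms of LEMMA 2.6 vanish in degrees `n ≥ 3`,
so `K_nE/pK_nE = 0`, i.e. `K_nE` is `p`-divisible; in degree `2` the left term `K₂F̄/p` vanishes and
`∂ : K₂E/pK₂E ≅ K₁F̄/pK₁F̄ = F̄•/F̄•ᵖ` (cyclic of order `gcd(p, q − 1)`, the `p`-part of Moore's cyclic group of order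
`m`).  The residue characteristic itself (`p = char F̄`, where Milnor uses Moore's theorem and, for `p | m`, the norm
residue symbol) is not treated here.

## What is formalised (`E` henselian — in particular complete — discretely valued, `F̄ = ValResidueField v` finite,
`(p : F̄) ≠ 0`; tree indexing `∂ = boundary v hπ n : K_{n+1}E → K_nF̄`)

* `modP_eq_zero_of_forall_eq_zero`: `A/pA = 0` when `A = 0` (plumbing).
* **`modP_milnorK_eq_zero_of_finite_residueField`**: every element of `K_{n+3}E/p` is `0`; equivalently
  **`exists_zsmul_eq_of_finite_residueField`**: every `z ∈ K_{n+3}E` is `p·y` («K_nF is divisible for n ≥ 3», the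
  prime-to-`char F̄` part).
* **`bijective_boundaryModP_two_of_finite_residueField`**: `∂ : K₂E/p → K₁F̄/p` is a bijection
  (`modP_two_eq_zero_iff_of_finite_residueField`).
* «If p does not divide m»: `K₁F̄/p = 0` when `gcd(#F̄•, p) = 1` (`modP_milnorK_one_eq_zero_of_coprime`, any field),
  hence **`K₂E/p = 0`** (`modP_milnorK_two_eq_zero_of_coprime`, `exists_zsmul_eq_two_of_coprime`).

## References

* [Milnor1970] J. Milnor, *Algebraic K-theory and quadratic forms*, Invent. Math. 9 (1970) 318–344 — §1 Example 1.7
  (p. 321), Example 1.5 (p. 321); §2 Lemma 2.6 (p. 327).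
* C. Moore, *Group extensions of p-adic and adelic linear groups*, Publ. Math. IHÉS 35 (1968) — Milnor's reference [10];
  cited through [Milnor1970], not used.

Provenance: lane `lit-hodgefound`, seat `lit-hodgefound-p27` gen 51 (agent `literature-prover-lit-hodgefound-p27-g51-0`),
row g51-#10.
-/

set_option autoImplicit false

noncomputable section

namespace Literature.RingTheory.KTheory

open Function

/-- `A/pA` is trivial when `A` is: every class is `0`. [cite: Milnor1970, §2 Lemma 2.6 (p0010 L18–L21)] -/
theorem modP_eq_zero_of_forall_eq_zero {A : Type*} [AddCommGroup A] (p : ℕ) (hA : ∀ a : A, a = 0) (ξ : ModP A p) :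
    ξ = 0 := by
  induction ξ using QuotientAddGroup.induction_on with
  | H y => rw [hA y, QuotientAddGroup.mk_zero]

namespace MilnorK

variable {E : Type*} [Field E] (v : Valuation E (WithZero (Multiplicative ℤ))) {π : Eˣ}
  [HenselianLocalRing v.valuationSubring] [Finite (ValResidueField v)] (p : ℕ)

/-- **EXAMPLE 1.7, `n ≥ 3`, away from the residue characteristic: `K_nE/pK_nE = 0`** (here `K_{n+3}E`) for `E`
henselian discretely valued with finite residue field `F̄` and `p ≠ char F̄` — by LEMMA 2.6, `K_{n+3}E/p ≅ K_{n+3}F̄/p ⊕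
K_{n+2}F̄/p`, and both vanish by EXAMPLE 1.5 (`π` is any prime element of `v`). [cite: Milnor1970, §1 Example 1.7 «K_nF is divisible for n ≥ 3» (p0004 L18–L26); §2 Lemma 2.6 (p0010 L17–L21); §1 Example 1.5 (p0004 L8–L12)] -/
theorem modP_milnorK_eq_zero_of_finite_residueField (hπ : addVal v π = 1) (hp : (p : ValResidueField v) ≠ 0) {n : ℕ}
    (ξ : ModP (MilnorK E (n + 3)) p) : ξ = 0 := by
  have hbij := bijective_psiModP_prod_boundaryModP_of_henselian v hπ p hp (n := n + 2)
  refine hbij.1 ?_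
  change (modPMap p (psi v hπ (n + 3)) ξ, modPMap p (boundary v hπ (n + 2)) ξ) =
    (modPMap p (psi v hπ (n + 3)) 0, modPMap p (boundary v hπ (n + 2)) 0)
  rw [modP_eq_zero_of_forall_eq_zero p (fun a => eq_zero_of_finite a) (modPMap p (psi v hπ (n + 3)) ξ),
    modP_eq_zero_of_forall_eq_zero p (fun a => eq_zero_of_finite a) (modPMap p (boundary v hπ (n + 2)) ξ),
    map_zero, map_zero]

/-- **`K_nE` is `p`-divisible for `n ≥ 3`** (`p ≠ char F̄`): every `z ∈ K_{n+3}E` is `p·y`. [cite: Milnor1970, §1 Example 1.7 «K_nF is divisible for n ≥ 3» (p0004 L18–L26); §2 Lemma 2.6 (p0010 L17–L21)] -/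
theorem exists_zsmul_eq_of_finite_residueField (hπ : addVal v π = 1) (hp : (p : ValResidueField v) ≠ 0) {n : ℕ} (z : MilnorK E (n + 3)) :
    ∃ y : MilnorK E (n + 3), (p : ℤ) • y = z := by
  have h0 : ((z : MilnorK E (n + 3)) : ModP (MilnorK E (n + 3)) p) = 0 :=
    modP_milnorK_eq_zero_of_finite_residueField v p hπ hp _
  have hmem : z ∈ pMultiples (MilnorK E (n + 3)) p := (QuotientAddGroup.eq_zero_iff z).1 h0
  exact (mem_pMultiples_iff (MilnorK E (n + 3)) p).1 hmem

/-- **EXAMPLE 1.7 in degree `2`, away from the residue characteristic: `∂ : K₂E/pK₂E → K₁F̄/pK₁F̄ = F̄•/F̄•ᵖ` is a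
bijection** (LEMMA 2.6 with `K₂F̄/p = 0` by EXAMPLE 1.5) — the prime-to-`char F̄` shadow of «K₂F is the direct sum of a
cyclic group of order m and a divisible group». [cite: Milnor1970, §1 Example 1.7 (p0004 L18–L26); §2 Lemma 2.6 (p0010 L17–L21); §1 Example 1.5 (p0004 L8–L12)] -/
theorem bijective_boundaryModP_two_of_finite_residueField (hπ : addVal v π = 1) (hp : (p : ValResidueField v) ≠ 0) :
    Function.Bijective (modPMap p (boundary v hπ 1) : ModP (MilnorK E 2) p → ModP (MilnorK (ValResidueField v) 1) p) := by
  have hbij := bijective_psiModP_prod_boundaryModP_of_henselian v hπ p hp (n := 1)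
  refine ⟨fun ξ₁ ξ₂ h => hbij.1 ?_, boundaryModP_surjective v hπ p⟩
  change (modPMap p (psi v hπ 2) ξ₁, modPMap p (boundary v hπ 1) ξ₁) =
    (modPMap p (psi v hπ 2) ξ₂, modPMap p (boundary v hπ 1) ξ₂)
  rw [h, modP_eq_zero_of_forall_eq_zero p (fun a => eq_zero_of_finite a) (modPMap p (psi v hπ 2) ξ₁),
    modP_eq_zero_of_forall_eq_zero p (fun a => eq_zero_of_finite a) (modPMap p (psi v hπ 2) ξ₂)]

/-- `K₂E/p`: a class is `0` iff its tame symbol class `∂[x] ∈ K₁F̄/p` is `0`. [cite: Milnor1970, §1 Example 1.7 (p0004 L18–L26); §2 Lemma 2.6 (p0010 L17–L21)] -/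
theorem modP_two_eq_zero_iff_of_finite_residueField (hπ : addVal v π = 1) (hp : (p : ValResidueField v) ≠ 0) (ξ : ModP (MilnorK E 2) p) :
    ξ = 0 ↔ modPMap p (boundary v hπ 1) ξ = 0 := by
  refine ⟨fun h => by rw [h, map_zero], fun h => ?_⟩
  exact (bijective_boundaryModP_two_of_finite_residueField v p hπ hp).1 (by rw [h, map_zero])

/-! ### «If p does not divide m, then K₂F/pK₂F = 0» -/

omit [HenselianLocalRing v.valuationSubring] [Finite (ValResidueField v)] in
/-- `K₁F̄/p = 0` when `gcd(#F̄•, p) = 1`: every unit is a `p`-th power (the `p`-th power map is a bijection of a finite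
group of order prime to `p`). [cite: Milnor1970, §1 Example 1.7 «If p does not divide m» (p0004 L22–L24); Example 1.5 «K₁F is cyclic, say of order q − 1» (p0004 L8–L9)] -/
theorem modP_milnorK_one_eq_zero_of_coprime {F : Type*} [Field F] (p : ℕ) (hcop : (Nat.card Fˣ).Coprime p)
    (ξ : ModP (MilnorK F 1) p) : ξ = 0 := by
  induction ξ using QuotientAddGroup.induction_on with
  | H z =>
    refine (QuotientAddGroup.eq_zero_iff z).2 ((mem_pMultiples_iff (MilnorK F 1) p).2 ?_)
    refine ⟨symbol ![(powCoprime hcop).symm (Additive.toMul (oneEquiv F z))], (oneEquiv F).injective ?_⟩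
    rw [map_zsmul, oneEquiv_symbol, Matrix.cons_val_zero, ← ofMul_zpow, zpow_natCast, ← powCoprime_apply hcop,
      Equiv.apply_symm_apply, ofMul_toMul]

/-- **«If p does not divide m, then […] K₂F/pK₂F = 0»** away from the residue characteristic: for `E` henselian
discretely valued with finite residue field `F̄`, `p ≠ char F̄` and `gcd(#F̄•, p) = 1`, every class of `K₂E/p` vanishes
(`∂ : K₂E/p ≅ K₁F̄/p = 0`). [cite: Milnor1970, §1 Example 1.7 «If p does not divide m, then Moore's theorem clearly implies that K₂F/pK₂F = 0» (p0004 L22–L24); §2 Lemma 2.6 (p0010 L17–L21)] -/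
theorem modP_milnorK_two_eq_zero_of_coprime (hπ : addVal v π = 1) (hp : (p : ValResidueField v) ≠ 0)
    (hcop : (Nat.card (ValResidueField v)ˣ).Coprime p) (ξ : ModP (MilnorK E 2) p) : ξ = 0 :=
  (modP_two_eq_zero_iff_of_finite_residueField v p hπ hp ξ).2 (modP_milnorK_one_eq_zero_of_coprime p hcop _)

/-- The same as `p`-divisibility: every `z ∈ K₂E` is `p·y` when `gcd(#F̄•, p) = 1` (and `p ≠ char F̄`).
[cite: Milnor1970, §1 Example 1.7 (p0004 L22–L24); §2 Lemma 2.6 (p0010 L17–L21)] -/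
theorem exists_zsmul_eq_two_of_coprime (hπ : addVal v π = 1) (hp : (p : ValResidueField v) ≠ 0)
    (hcop : (Nat.card (ValResidueField v)ˣ).Coprime p) (z : MilnorK E 2) : ∃ y : MilnorK E 2, (p : ℤ) • y = z := by
  have h0 : ((z : MilnorK E 2) : ModP (MilnorK E 2) p) = 0 := modP_milnorK_two_eq_zero_of_coprime v p hπ hp hcop _
  have hmem : z ∈ pMultiples (MilnorK E 2) p := (QuotientAddGroup.eq_zero_iff z).1 h0
  exact (mem_pMultiples_iff (MilnorK E 2) p).1 hmem

end MilnorK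

/-! ### The order of `K₂E/pK₂E`: `gcd(p, q − 1)`, the `p`-part of Moore's cyclic group (appended, g52-#5)

EXAMPLE 1.7 describes `K₂F` of a local field as «the direct sum of a cyclic group of order m and a divisible group» (Moore),
`m` the number of roots of unity, so that `K₂F/pK₂F` is cyclic of order `gcd(p, m)`.  Away from the residue characteristic
this order is computed here WITHOUT Moore's theorem: `∂ : K₂E/p ≅ K₁F̄/p = F̄•/F̄•ᵖ` (LEMMA 2.6, EXAMPLE 1.5) and `F̄•` is
«cyclic, say of order q − 1», whence `#(K₂E/pK₂E) = gcd(p, q − 1)` (`= gcd(p, m)`, the roots of unity of order prime to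
the residue characteristic reducing isomorphically into `F̄•`). -/

section Order

/-- **For a finite cyclic group `A` of order `N`, `A/pA` has exactly `gcd(N, p)` elements** (`pA` is generated by `p·g`
for a generator `g`, of order `N/gcd(N,p)`). [cite: Milnor1970, §1 Example 1.5 «K₁F is cyclic, say of order q − 1, and is generated by any primitive (q−1)-th root of unity» (p0004 L8–L9)] -/
theorem natCard_modP_of_isAddCyclic (A : Type*) [AddCommGroup A] [Finite A] [IsAddCyclic A] (p : ℕ) :
    Nat.card (ModP A p) = Nat.gcd (Nat.card A) p := by
  obtain ⟨g, hg⟩ := IsAddCyclic.exists_generator (α := A)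
  have hN : addOrderOf g = Nat.card A := addOrderOf_eq_card_of_forall_mem_zmultiples hg
  -- `pA = ℤ·(p·g)`
  have hrange : pMultiples A p = AddSubgroup.zmultiples (p • g) := by
    ext x
    rw [mem_pMultiples_iff, AddSubgroup.mem_zmultiples_iff]
    constructor
    · rintro ⟨y, rfl⟩
      obtain ⟨k, rfl⟩ := AddSubgroup.mem_zmultiples_iff.1 (hg y)
      exact ⟨k, by rw [natCast_zsmul, smul_comm]⟩
    · rintro ⟨k, rfl⟩
      exact ⟨k • g, by rw [natCast_zsmul, smul_comm]⟩
  have hsub : Nat.card (pMultiples A p) = Nat.card A / Nat.gcd (Nat.card A) p := by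
    rw [hrange, Nat.card_zmultiples, addOrderOf_nsmul g, hN]
  have hpos : 0 < Nat.card A := Nat.card_pos
  have hdvd : Nat.gcd (Nat.card A) p ∣ Nat.card A := Nat.gcd_dvd_left _ _
  have hmul := (pMultiples A p).card_mul_index
  rw [AddSubgroup.index_eq_card, hsub] at hmul
  -- `(N / d) · #(A/pA) = N = (N / d) · d`
  have hq : 0 < Nat.card A / Nat.gcd (Nat.card A) p := Nat.div_pos (Nat.le_of_dvd hpos hdvd) (Nat.pos_of_ne_zero
    (fun h => by rw [Nat.gcd_eq_zero_iff] at h; omega))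
  refine Nat.eq_of_mul_eq_mul_left hq ?_
  rw [hmul]
  exact (Nat.div_mul_cancel hdvd).symm

/-- **`#(K₁F/pK₁F) = gcd(#F•, p)`** for a finite field `F` (`K₁F ≅ F•` cyclic, `oneEquiv`).
[cite: Milnor1970, §1 Example 1.5 «K₁F is cyclic, say of order q − 1» (p0004 L8–L9); Example 1.7 (p0004 L18–L24)] -/
theorem natCard_modP_milnorK_one_of_finite (F : Type*) [Field F] [Finite F] (p : ℕ) :
    Nat.card (ModP (MilnorK F 1) p) = Nat.gcd (Nat.card Fˣ) p := by
  have hmap : (pMultiples (MilnorK F 1) p).map (MilnorK.oneEquiv F) = pMultiples (Additive Fˣ) p := by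
    ext x
    simp only [AddSubgroup.mem_map, mem_pMultiples_iff, AddMonoidHom.coe_coe]
    constructor
    · rintro ⟨y, ⟨z, rfl⟩, rfl⟩
      exact ⟨MilnorK.oneEquiv F z, by rw [map_zsmul]⟩
    · rintro ⟨z, rfl⟩
      exact ⟨(p : ℤ) • (MilnorK.oneEquiv F).symm z, ⟨_, rfl⟩, by rw [map_zsmul, AddEquiv.apply_symm_apply]⟩
  have e : ModP (MilnorK F 1) p ≃+ ModP (Additive Fˣ) p :=
    QuotientAddGroup.congr (pMultiples (MilnorK F 1) p) (pMultiples (Additive Fˣ) p) (MilnorK.oneEquiv F) hmap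
  rw [Nat.card_congr e.toEquiv, natCard_modP_of_isAddCyclic]
  rfl

namespace MilnorK

variable {E : Type*} [Field E] (v : Valuation E (WithZero (Multiplicative ℤ))) {π : Eˣ}
  [HenselianLocalRing v.valuationSubring] [Finite (ValResidueField v)] (p : ℕ)

/-- **`#(K₂E/pK₂E) = gcd(#F̄•, p) = gcd(q − 1, p)`** for `E` henselian discretely valued with finite residue field `F̄`
(`q = #F̄`) and `p ≠ char F̄`: through `∂ : K₂E/p ≅ K₁F̄/p` and `K₁F̄ ≅ F̄•` cyclic of order `q − 1` — the `p`-part of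
Moore's «cyclic group of order m». [cite: Milnor1970, §1 Example 1.7 «K₂F is the direct sum of a cyclic group of order m and a divisible group» (p0004 L18–L24); §2 Lemma 2.6 (p0010 L17–L21); §1 Example 1.5 (p0004 L8–L9)] -/
theorem natCard_modP_two_of_finite_residueField (hπ : addVal v π = 1) (hp : (p : ValResidueField v) ≠ 0) :
    Nat.card (ModP (MilnorK E 2) p) = Nat.gcd (Nat.card (ValResidueField v)ˣ) p := by
  rw [Nat.card_eq_of_bijective _ (bijective_boundaryModP_two_of_finite_residueField v p hπ hp),
    natCard_modP_milnorK_one_of_finite]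

/-- In terms of `q = #F̄`: `#(K₂E/pK₂E) = gcd(q − 1, p)`. [cite: Milnor1970, §1 Example 1.7 (p0004 L18–L24); Example 1.5 «of order q − 1» (p0004 L8–L9)] -/
theorem natCard_modP_two_eq_gcd_card_sub_one (hπ : addVal v π = 1) (hp : (p : ValResidueField v) ≠ 0) :
    Nat.card (ModP (MilnorK E 2) p) = Nat.gcd (Nat.card (ValResidueField v) - 1) p := by
  rw [natCard_modP_two_of_finite_residueField v p hπ hp, Nat.card_units]

/-- **`#(K₂E/pK₂E) = p` when `p` is a prime dividing `q − 1`** (the cyclic summand of order `m` then has non-trivial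
`p`-part). [cite: Milnor1970, §1 Example 1.7 (p0004 L18–L24)] -/
theorem natCard_modP_two_eq_of_dvd (hπ : addVal v π = 1) (hp : (p : ValResidueField v) ≠ 0)
    (hdvd : p ∣ Nat.card (ValResidueField v)ˣ) : Nat.card (ModP (MilnorK E 2) p) = p := by
  rw [natCard_modP_two_of_finite_residueField v p hπ hp, Nat.gcd_eq_right hdvd]

/-- … and `#(K₂E/pK₂E) = 1` when `gcd(#F̄•, p) = 1` («If p does not divide m, then … K₂F/pK₂F = 0», the numeric form of
`modP_milnorK_two_eq_zero_of_coprime`). [cite: Milnor1970, §1 Example 1.7 (p0004 L22–L24)] -/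
theorem natCard_modP_two_eq_one_of_coprime (hπ : addVal v π = 1) (hp : (p : ValResidueField v) ≠ 0)
    (hcop : (Nat.card (ValResidueField v)ˣ).Coprime p) : Nat.card (ModP (MilnorK E 2) p) = 1 := by
  rw [natCard_modP_two_of_finite_residueField v p hπ hp]
  exact hcop

end MilnorK

end Order

end Literature.RingTheory.KTheory

end
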